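import Summits.AtomisticToContinuum.HydrodynamicLimit.Theorems.BoxDissipativeWeakStrongRelativeEnergyStabilityCutEosMaster
import HarnessLib

/-!
# Crux `RelativeEnergyStability` (stmt-AtomisticToContinuum-17653), line `registered`:
helpers of the stub `stub_clampedRelEnergyCoercive` (S3') — pointwise coercivity, case by case

The deterministic core of S3' "vanishing mean clamped box relative energy forces convergence in
probability of the tested empirical fields": Březina–Feireisl's CLAMPED relative energy
`ℰ_{Z_{a,b}}(w | r, W, Θ)` (`StrongPointData.relEnergyZ`, BrezinaFeireisl2018 (3.3)–(3.4)) of the cut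
hard-sphere law `cutEOS σ η₁` with a DEEP lower clamp (`μ_cut(r,Θ) + Θ a ≤ −1`) controls the deviation
`dev(w) = |ρ − r| + ‖m − rW‖ + |½|m|²/ρ + E_int − E(r,W,Θ)|` of a phase-space state `w = (ρ, E_int, m)` from
the strong conserved state, region by region:

* `co_dev_general`, `co_dev_near` — the deviation against the relative kinetic energy
  `Kin = ρ/2 ∑(mᵢ/ρ − Wᵢ)²` (`‖m − ρW‖² = 2ρ Kin`, `co_norm_sub_sq`): an affine bound
  `dev ≤ G₀(1 + ρ + Kin + E_int)` and, near the strong state, the refined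
  `dev ≤ A|ρ − r| + B‖m − ρW‖ + Kin + 3/2 ρ|ϑ − Θ|`;
* `co_vacuum`, `co_cold_lower`, `co_frozen_lower`, `co_hot_lower` — the clamped energy from below: `= p_cut(r,Θ)`
  on the vacuum, `≥ Kin + E_int + ρ + p_cut` on `{s < a}` (deep clamp), `≥ Kin + p_min/2` on frozen states of
  small density (Lean's junk `log 0 = 0` costs `≤ Cρ`), and `≥ Kin + ½ R_ideal` on `{s ≥ a}`
  (`relEnergyZ ≥ relEnergyFull`, `R_cut ≥ ½ R_ideal` by `cm_relEnergyThermo_cut_ge`);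
* `co_case_far`, `co_case_near` (registered helper sub-goal) — BF's residual/essential coercivity of the
  ideal gas (`relEnergyThermo_coercivity_near_far`, `density_le_of_relEnergyThermo`,
  `energy_entropy_le_of_relEnergyThermo`) turned into `dev ≤ C ℰ_Z` far from, and
  `dev ≤ C (ℰ_Z + √ℰ_Z)` near the strong state.

References: BrezinaFeireisl2018 §3.1–3.2 (3.8); FeireislNovotny2012 §3; Dafermos1979.
-/

noncomputable section

namespace Summit.AtomisticToContinuum.HydrodynamicLimit.Theorems.RES

open MeasureTheory Filter Set
open scoped ENNReal Topology
open Summit.AtomisticToContinuum.HydrodynamicLimit.Theses.BoxDissipativeWeakStrong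
open Literature.MathematicalPhysics.KineticTheory Literature.Analysis.FluidPDE
open Literature.Analysis.FluidPDE.CompressibleEuler
open Literature.Analysis.FluidPDE.CompressibleEuler.EulerPhase
open Literature.Analysis.FluidPDE.CompressibleEuler.StrongPointData

/-! ## Algebra of the deviation of a phase-space state from a strong state -/

/-- Coordinates of `m − ρ • W`. -/
theorem co_sub_smul_apply (m W : V3) (ρ : ℝ) (i : Fin 3) : (m - ρ • W) i = m i - ρ * W i := by
  simp only [PiLp.sub_apply, PiLp.smul_apply, smul_eq_mul]

/-- `|∑ yᵢ Wᵢ| ≤ 3 ‖y‖ ‖W‖` (coordinates are bounded by the Euclidean norm). -/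
theorem co_abs_sum_mul_le (y W : V3) : |∑ i : Fin 3, y i * W i| ≤ 3 * ‖y‖ * ‖W‖ := by
  calc |∑ i : Fin 3, y i * W i| ≤ ∑ i : Fin 3, |y i * W i| := Finset.abs_sum_le_sum_abs _ _
    _ ≤ ∑ _i : Fin 3, ‖y‖ * ‖W‖ := Finset.sum_le_sum fun i _ => by
        rw [abs_mul]
        have h1 : |y i| ≤ ‖y‖ := Real.norm_eq_abs _ ▸ PiLp.norm_apply_le y i
        have h2 : |W i| ≤ ‖W‖ := Real.norm_eq_abs _ ▸ PiLp.norm_apply_le W i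
        exact mul_le_mul h1 h2 (abs_nonneg _) (norm_nonneg _)
    _ = 3 * ‖y‖ * ‖W‖ := by simp; ring

/-- The relative kinetic energy `Kin = ρ/2 ∑ (mᵢ/ρ − Wᵢ)²` is non-negative for `ρ ≥ 0`. -/
theorem co_kin_nonneg (W : V3) {w : EulerPhase} (hρ : 0 ≤ dens w) :
    0 ≤ dens w / 2 * ∑ i : Fin 3, (mom w i / dens w - W i) ^ 2 :=
  mul_nonneg (by linarith) (Finset.sum_nonneg fun i _ => sq_nonneg _)

/-- The kinetic energy against the relative kinetic energy:
`½|m|²/ρ = Kin + ∑ (mᵢ − ρWᵢ) Wᵢ + ρ|W|²/2` (`ρ ≠ 0`). -/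
theorem co_kineticEnergy_eq (W : V3) {w : EulerPhase} (hρ : dens w ≠ 0) :
    kineticEnergy w = dens w / 2 * ∑ i : Fin 3, (mom w i / dens w - W i) ^ 2 +
      (∑ i : Fin 3, (mom w i - dens w * W i) * W i) + dens w * ‖W‖ ^ 2 / 2 := by
  have hn1 : ‖mom w‖ ^ 2 = ∑ i : Fin 3, mom w i ^ 2 := by rw [EuclideanSpace.real_norm_sq_eq]
  have hn2 : ‖W‖ ^ 2 = ∑ i : Fin 3, W i ^ 2 := by rw [EuclideanSpace.real_norm_sq_eq]
  unfold kineticEnergy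
  rw [hn1, hn2]
  simp only [Fin.sum_univ_three]
  field_simp
  ring

/-- `‖m − ρ•W‖² = ρ² ∑ (mᵢ/ρ − Wᵢ)²` (`= 2ρ · Kin`). -/
theorem co_norm_sub_sq (W : V3) {w : EulerPhase} (hρ : dens w ≠ 0) :
    ‖mom w - dens w • W‖ ^ 2 = dens w ^ 2 * ∑ i : Fin 3, (mom w i / dens w - W i) ^ 2 := by
  rw [EuclideanSpace.real_norm_sq_eq, Finset.mul_sum]
  refine Finset.sum_congr rfl fun i _ => ?_
  rw [co_sub_smul_apply]
  field_simp

/-- `‖m − ρ•W‖ ≤ ρ + Kin` (AM–GM on `‖m − ρ•W‖² = 2ρ Kin`). -/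
theorem co_norm_sub_le (W : V3) {w : EulerPhase} (hρ : 0 < dens w) :
    ‖mom w - dens w • W‖ ≤ dens w + dens w / 2 * ∑ i : Fin 3, (mom w i / dens w - W i) ^ 2 := by
  have hS0 : 0 ≤ ∑ i : Fin 3, (mom w i / dens w - W i) ^ 2 := Finset.sum_nonneg fun i _ => sq_nonneg _
  obtain ⟨S, hS⟩ : ∃ S, S = ∑ i : Fin 3, (mom w i / dens w - W i) ^ 2 := ⟨_, rfl⟩
  have hsq : ‖mom w - dens w • W‖ ^ 2 = dens w ^ 2 * S := by rw [co_norm_sub_sq W hρ.ne', hS]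
  rw [← hS] at hS0 ⊢
  have h : ‖mom w - dens w • W‖ ^ 2 ≤ (dens w + dens w / 2 * S) ^ 2 := by
    rw [hsq]
    nlinarith [sq_nonneg (dens w - dens w / 2 * S), mul_nonneg hρ.le hS0,
      mul_nonneg (mul_nonneg hρ.le hρ.le) hS0]
  have := abs_le_of_sq_le_sq h (by nlinarith [mul_nonneg hρ.le hS0])
  rwa [abs_norm] at this

/-- `m − r•W = (m − ρ•W) + (ρ − r)•W`, in norm. -/
theorem co_norm_mom_sub_le (r : ℝ) (W : V3) (w : EulerPhase) :
    ‖mom w - r • W‖ ≤ ‖mom w - dens w • W‖ + |dens w - r| * ‖W‖ := by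
  have : mom w - r • W = (mom w - dens w • W) + (dens w - r) • W := by
    rw [sub_smul]; abel
  rw [this]
  exact (norm_add_le _ _).trans (by rw [norm_smul, Real.norm_eq_abs])

/-- **General deviation bound off the vacuum**: for `ρ > 0`, `E_int ≥ 0` and strong data bounded by
`rM, ΘM, WM`, `dev ≤ G₀ (1 + ρ + Kin + E_int)` with `G₀ = 2 + 4WM + WM² + rM(1 + WM + WM² + 2ΘM)`. -/
theorem co_dev_general {r Θ rM ΘM WM : ℝ} {W : V3} {w : EulerPhase} (hρ : 0 < dens w)
    (hE : 0 ≤ ien w) (hr0 : 0 ≤ r) (hr : r ≤ rM) (hΘ0 : 0 ≤ Θ) (hΘ : Θ ≤ ΘM) (hWM : ‖W‖ ≤ WM) :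
    |dens w - r| + ‖mom w - r • W‖ + |kineticEnergy w + ien w - totalEnergyDensity r W Θ| ≤
      (2 + 4 * WM + WM ^ 2 + rM * (1 + WM + WM ^ 2 + 2 * ΘM)) *
        (1 + dens w + dens w / 2 * ∑ i : Fin 3, (mom w i / dens w - W i) ^ 2 + ien w) := by
  have hK0 := co_kin_nonneg W hρ.le
  have hy1 := co_norm_sub_le W hρ
  have hkin := co_kineticEnergy_eq W hρ.ne'
  obtain ⟨K, hK⟩ : ∃ K, K = dens w / 2 * ∑ i : Fin 3, (mom w i / dens w - W i) ^ 2 := ⟨_, rfl⟩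
  rw [← hK] at hK0 hy1 hkin ⊢
  obtain ⟨ny, hny⟩ : ∃ ny, ny = ‖mom w - dens w • W‖ := ⟨_, rfl⟩
  rw [← hny] at hy1
  have hW0 : 0 ≤ ‖W‖ := norm_nonneg W
  have hWM0 : 0 ≤ WM := hW0.trans hWM
  have hrM0 : 0 ≤ rM := hr0.trans hr
  have hΘM0 : 0 ≤ ΘM := hΘ0.trans hΘ
  have hny0 : 0 ≤ ny := by rw [hny]; exact norm_nonneg _
  -- density
  have f1 : |dens w - r| ≤ dens w + rM := by
    rw [abs_le]; constructor <;> linarith [hρ.le]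
  -- momentum
  have f2 : ‖mom w - r • W‖ ≤ ny + |dens w - r| * ‖W‖ := hny ▸ co_norm_mom_sub_le r W w
  have f3 : |dens w - r| * ‖W‖ ≤ (dens w + rM) * WM := mul_le_mul f1 hWM hW0 (by linarith)
  -- energy
  have hinner : |∑ i : Fin 3, (mom w i - dens w * W i) * W i| ≤ 3 * ny * ‖W‖ := by
    have := co_abs_sum_mul_le (mom w - dens w • W) W
    simpa only [hny, co_sub_smul_apply] using this
  have f4 : kineticEnergy w ≤ K + 3 * ny * ‖W‖ + dens w * ‖W‖ ^ 2 / 2 := by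
    rw [hkin]
    linarith [le_abs_self (∑ i : Fin 3, (mom w i - dens w * W i) * W i)]
  have hkin0 : 0 ≤ kineticEnergy w := kineticEnergy_nonneg hρ.le
  have hW2 : ‖W‖ ^ 2 ≤ WM ^ 2 := pow_le_pow_left₀ hW0 hWM 2
  have hEt0 : 0 ≤ totalEnergyDensity r W Θ := by unfold totalEnergyDensity; positivity
  have f5 : totalEnergyDensity r W Θ ≤ rM * (WM ^ 2 / 2 + 3 / 2 * ΘM) := by
    unfold totalEnergyDensity
    exact mul_le_mul hr (by linarith) (by positivity) hrM0
  have f6 : |kineticEnergy w + ien w - totalEnergyDensity r W Θ| ≤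
      kineticEnergy w + ien w + totalEnergyDensity r W Θ := by
    rw [abs_le]; constructor <;> linarith
  have f7 : ny * ‖W‖ ≤ (dens w + K) * WM := mul_le_mul hy1 hWM hW0 (by linarith)
  have f8 : dens w * ‖W‖ ^ 2 ≤ dens w * WM ^ 2 := mul_le_mul_of_nonneg_left hW2 hρ.le
  -- combine: `dev ≤ ρ (2 + 4WM + WM²/2) + K (2 + 3WM) + E_int + rM (1 + WM + WM²/2 + 3/2 ΘM)`
  have hsum : |dens w - r| + ‖mom w - r • W‖ + |kineticEnergy w + ien w - totalEnergyDensity r W Θ| ≤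
      dens w * (2 + 4 * WM + WM ^ 2 / 2) + K * (2 + 3 * WM) + ien w +
        rM * (1 + WM + WM ^ 2 / 2 + 3 / 2 * ΘM) := by
    linarith
  refine hsum.trans ?_
  obtain ⟨G₀, hG₀⟩ : ∃ G₀, G₀ = 2 + 4 * WM + WM ^ 2 + rM * (1 + WM + WM ^ 2 + 2 * ΘM) := ⟨_, rfl⟩
  rw [← hG₀]
  have p1 := mul_nonneg hrM0 hWM0
  have p2 := mul_nonneg hrM0 hΘM0
  have p3 := mul_nonneg hrM0 (sq_nonneg WM)
  have p4 := sq_nonneg WM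
  have e1 : dens w * (2 + 4 * WM + WM ^ 2 / 2) ≤ G₀ * dens w := by
    rw [mul_comm]
    exact mul_le_mul_of_nonneg_right (by rw [hG₀]; linarith) hρ.le
  have e2 : K * (2 + 3 * WM) ≤ G₀ * K := by
    rw [mul_comm]
    exact mul_le_mul_of_nonneg_right (by rw [hG₀]; linarith) hK0
  have e3 : ien w ≤ G₀ * ien w := le_mul_of_one_le_left hE (by rw [hG₀]; linarith)
  have e4 : rM * (1 + WM + WM ^ 2 / 2 + 3 / 2 * ΘM) ≤ G₀ := by rw [hG₀]; linarith
  have hexp : G₀ * (1 + dens w + K + ien w) = G₀ + G₀ * dens w + G₀ * K + G₀ * ien w := by ring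
  rw [hexp]
  linarith

/-- **Refined deviation bound near the strong state** (`ρ > 0`, `Θ ≥ 0`):
`dev ≤ |ρ − r|(1 + ‖W‖ + ‖W‖²/2 + 3Θ/2) + ‖m − ρW‖(1 + 3‖W‖) + Kin + 3/2 ρ |ϑ − Θ|`, `ϑ = 2E_int/(3ρ)`. -/
theorem co_dev_near (r : ℝ) {Θ : ℝ} (W : V3) {w : EulerPhase} (hρ : 0 < dens w) (hΘ0 : 0 ≤ Θ) :
    |dens w - r| + ‖mom w - r • W‖ + |kineticEnergy w + ien w - totalEnergyDensity r W Θ| ≤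
      |dens w - r| * (1 + ‖W‖ + ‖W‖ ^ 2 / 2 + 3 / 2 * Θ) +
        ‖mom w - dens w • W‖ * (1 + 3 * ‖W‖) +
        dens w / 2 * ∑ i : Fin 3, (mom w i / dens w - W i) ^ 2 +
        3 / 2 * dens w * |2 * ien w / (3 * dens w) - Θ| := by
  have hρ' : dens w ≠ 0 := hρ.ne'
  have hK0 := co_kin_nonneg W hρ.le
  have hkin := co_kineticEnergy_eq W hρ'
  obtain ⟨K, hK⟩ : ∃ K, K = dens w / 2 * ∑ i : Fin 3, (mom w i / dens w - W i) ^ 2 := ⟨_, rfl⟩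
  rw [← hK] at hK0 hkin ⊢
  obtain ⟨ϑ, hϑ⟩ : ∃ ϑ, ϑ = 2 * ien w / (3 * dens w) := ⟨_, rfl⟩
  rw [← hϑ]
  obtain ⟨ny, hny⟩ : ∃ ny, ny = ‖mom w - dens w • W‖ := ⟨_, rfl⟩
  rw [← hny]
  have hW0 : 0 ≤ ‖W‖ := norm_nonneg W
  have hny0 : 0 ≤ ny := by rw [hny]; exact norm_nonneg _
  have hEi : ien w = 3 / 2 * dens w * ϑ := by rw [hϑ]; field_simp
  have f2 : ‖mom w - r • W‖ ≤ ny + |dens w - r| * ‖W‖ := hny ▸ co_norm_mom_sub_le r W w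
  have hinner : |∑ i : Fin 3, (mom w i - dens w * W i) * W i| ≤ 3 * ny * ‖W‖ := by
    have := co_abs_sum_mul_le (mom w - dens w • W) W
    simpa only [hny, co_sub_smul_apply] using this
  have hid : kineticEnergy w + ien w - totalEnergyDensity r W Θ =
      K + (∑ i : Fin 3, (mom w i - dens w * W i) * W i) + (dens w - r) * (‖W‖ ^ 2 / 2) +
        3 / 2 * (dens w * (ϑ - Θ) + Θ * (dens w - r)) := by
    rw [hkin, hEi, totalEnergyDensity]; ring
  have hi := abs_le.1 hinner
  have hW2 : 0 ≤ ‖W‖ ^ 2 / 2 := by positivity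
  have ha1 := mul_le_mul_of_nonneg_right (le_abs_self (dens w - r)) hW2
  have ha2 := mul_le_mul_of_nonneg_right (neg_abs_le (dens w - r)) hW2
  have hb1 := mul_le_mul_of_nonneg_left (le_abs_self (ϑ - Θ)) hρ.le
  have hb2 := mul_le_mul_of_nonneg_left (neg_abs_le (ϑ - Θ)) hρ.le
  have hc1 := mul_le_mul_of_nonneg_left (le_abs_self (dens w - r)) hΘ0
  have hc2 := mul_le_mul_of_nonneg_left (neg_abs_le (dens w - r)) hΘ0
  have f3 : |kineticEnergy w + ien w - totalEnergyDensity r W Θ| ≤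
      K + 3 * ny * ‖W‖ + |dens w - r| * (‖W‖ ^ 2 / 2) +
        3 / 2 * (dens w * |ϑ - Θ| + Θ * |dens w - r|) := by
    rw [hid, abs_le]
    constructor <;> linarith
  linarith [f2, f3, abs_nonneg (dens w - r)]

/-! ## The clamped relative energy from below, region by region -/

/-- **Vacuum**: `ℰ_Z(0 | r,W,Θ) = p_cut(r,Θ)` and `dev(0) = |r| + |r|‖W‖ + |E(r,W,Θ)|`. -/
theorem co_vacuum (σ η₁ a b r Θ : ℝ) (W : V3) :
    (strongData r W Θ).relEnergyZ (cutEOS σ η₁) (clamp a b) 0 = (cutEOS σ η₁).p r Θ ∧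
    |dens (0 : EulerPhase) - r| + ‖mom (0 : EulerPhase) - r • W‖ +
        |kineticEnergy (0 : EulerPhase) + ien (0 : EulerPhase) - totalEnergyDensity r W Θ| =
      |r| + |r| * ‖W‖ + |totalEnergyDensity r W Θ| := by
  refine ⟨cm_relEnergyZ_zero _ _ _, ?_⟩
  rw [kineticEnergy_of_dens_eq_zero cm_zero_phase.1, cm_zero_phase.1, cm_zero_phase.2.1,
    cm_zero_phase.2.2, zero_sub, abs_neg, zero_sub, norm_neg, norm_smul, Real.norm_eq_abs, zero_add,
    zero_sub, abs_neg]

/-- **Cold region** `{s < a}` (`ρ > 0`): the deep clamp `μ_cut(r,Θ) + Θa ≤ −1` gives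
`Kin + E_int + ρ + p_min ≤ ℰ_Z`. -/
theorem co_cold_lower {σ η₁ a b r Θ pmin : ℝ} (W : V3) {w : EulerPhase} (hρ : 0 < dens w) (hab : a ≤ b)
    (hcold : (cutEOS σ η₁).s (dens w) (stateTemp (cutEOS σ η₁) (dens w) (ien w)) < a)
    (hdeep : (cutEOS σ η₁).chemPotential r Θ + Θ * a ≤ -1) (hp : pmin ≤ (cutEOS σ η₁).p r Θ) :
    dens w / 2 * ∑ i : Fin 3, (mom w i / dens w - W i) ^ 2 + ien w + dens w + pmin ≤
      (strongData r W Θ).relEnergyZ (cutEOS σ η₁) (clamp a b) w := by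
  rw [cm_relEnergyZ_expand _ _ _ hρ.ne']
  have hcl : clamp a b ((cutEOS σ η₁).s (dens w) (stateTemp (cutEOS σ η₁) (dens w) (ien w))) = a := by
    simp only [clamp, min_eq_left (hcold.le.trans hab), max_eq_left hcold.le]
  rw [hcl]
  show dens w / 2 * ∑ i : Fin 3, (mom w i / dens w - W i) ^ 2 + ien w + dens w + pmin ≤
    dens w / 2 * ∑ i : Fin 3, (mom w i / dens w - W i) ^ 2 + ien w -
      dens w * (cutEOS σ η₁).chemPotential r Θ - Θ * (dens w * a) + (cutEOS σ η₁).p r Θ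
  have h1 := mul_le_mul_of_nonneg_left hdeep hρ.le
  linarith

/-- **Frozen states of small density** (`E_int = 0 < ρ ≤ ρs`, Lean's junk `log 0 = 0` in the entropy):
`Kin + p_min/2 ≤ ℰ_Z` as soon as `ρs (μM + ΘM·max|a||b|) ≤ p_min/2`. -/
theorem co_frozen_lower {σ η₁ a b r Θ pmin μM ΘM ρs : ℝ} (W : V3) {w : EulerPhase} (hρ : 0 < dens w)
    (hE : ien w = 0) (hab : a ≤ b) (hμ : |(cutEOS σ η₁).chemPotential r Θ| ≤ μM) (hΘ0 : 0 ≤ Θ)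
    (hΘ : Θ ≤ ΘM) (hp : pmin ≤ (cutEOS σ η₁).p r Θ) (hρs : dens w ≤ ρs)
    (hρs' : ρs * (μM + ΘM * max |a| |b|) ≤ pmin / 2) :
    dens w / 2 * ∑ i : Fin 3, (mom w i / dens w - W i) ^ 2 + pmin / 2 ≤
      (strongData r W Θ).relEnergyZ (cutEOS σ η₁) (clamp a b) w := by
  rw [cm_relEnergyZ_expand _ _ _ hρ.ne', hE]
  have hZb : |clamp a b ((cutEOS σ η₁).s (dens w) (stateTemp (cutEOS σ η₁) (dens w) 0))| ≤
      max |a| |b| := abs_clamp_le hab _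
  obtain ⟨ζ, hζ⟩ : ∃ ζ, ζ = clamp a b ((cutEOS σ η₁).s (dens w) (stateTemp (cutEOS σ η₁) (dens w) 0)) :=
    ⟨_, rfl⟩
  rw [← hζ] at hZb
  have hZb0 : 0 ≤ max |a| |b| := (abs_nonneg a).trans (le_max_left _ _)
  have hμM0 : 0 ≤ μM := (abs_nonneg _).trans hμ
  show dens w / 2 * ∑ i : Fin 3, (mom w i / dens w - W i) ^ 2 + pmin / 2 ≤
    dens w / 2 * ∑ i : Fin 3, (mom w i / dens w - W i) ^ 2 + 0 -
      dens w * (cutEOS σ η₁).chemPotential r Θ -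
      Θ * (dens w * clamp a b ((cutEOS σ η₁).s (dens w) (stateTemp (cutEOS σ η₁) (dens w) 0))) +
      (cutEOS σ η₁).p r Θ
  rw [← hζ]
  have h1 : dens w * (cutEOS σ η₁).chemPotential r Θ ≤ dens w * μM :=
    mul_le_mul_of_nonneg_left ((le_abs_self _).trans hμ) hρ.le
  have h2 : Θ * (dens w * ζ) ≤ ΘM * (dens w * max |a| |b|) := by
    calc Θ * (dens w * ζ) ≤ Θ * (dens w * max |a| |b|) :=
          mul_le_mul_of_nonneg_left (mul_le_mul_of_nonneg_left ((le_abs_self _).trans hZb) hρ.le) hΘ0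
      _ ≤ ΘM * (dens w * max |a| |b|) := mul_le_mul_of_nonneg_right hΘ (mul_nonneg hρ.le hZb0)
  have h3 : dens w * (μM + ΘM * max |a| |b|) ≤ ρs * (μM + ΘM * max |a| |b|) :=
    mul_le_mul_of_nonneg_right hρs (add_nonneg hμM0 (mul_nonneg (hΘ0.trans hΘ) hZb0))
  linarith

/-- **Hot region** `{s ≥ a}` in the open quadrant: `ℰ_Z ≥ relEnergyFull = Kin + R_cut ≥ Kin + ½ R_ideal` with
`R_ideal ≥ 0` the relative thermal energy of the monatomic ideal gas (`cm_relEnergyThermo_cut_ge`). -/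
theorem co_hot_lower {η₀ η₁ σ a b : ℝ} {F : ℝ → ℝ} (hF : AnalyticOnNhd ℝ F (Ioo (-η₀) η₀))
    (hEq : EqOn hsExcessFreeEnergy F (Ico 0 η₀)) (hη₁ : 0 < η₁) (hη₁₀ : η₁ < η₀) (hσ : 0 < σ)
    (hW' : ∀ η ∈ Ioo 0 η₁, (1 / 2 : ℝ) ≤ 1 + 2 * η * deriv F η + η ^ 2 * deriv (deriv F) η)
    (hZ1 : (1 / 2 : ℝ) ≤ 1 + η₁ * deriv F η₁) {r Θ : ℝ} (W : V3) (hr : 0 < r) (hΘ : 0 < Θ)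
    {w : EulerPhase} (hρ : 0 < dens w) (hE : 0 < ien w)
    (hsa : a ≤ (cutEOS σ η₁).s (dens w) (stateTemp (cutEOS σ η₁) (dens w) (ien w))) :
    0 ≤ (EulerEOS.monatomicExcess (fun _ => 1) (fun _ => 0)).relEnergyThermo r Θ (dens w)
        (2 * ien w / (3 * dens w)) ∧
    dens w / 2 * ∑ i : Fin 3, (mom w i / dens w - W i) ^ 2 +
        (EulerEOS.monatomicExcess (fun _ => 1) (fun _ => 0)).relEnergyThermo r Θ (dens w)
          (2 * ien w / (3 * dens w)) / 2 ≤
      (strongData r W Θ).relEnergyZ (cutEOS σ η₁) (clamp a b) w := by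
  have hst : stateTemp (cutEOS σ η₁) (dens w) (ien w) = 2 * ien w / (3 * dens w) := rfl
  have hϑ : 0 < 2 * ien w / (3 * dens w) := div_pos (by linarith) (by linarith)
  obtain ⟨hG0, hS0, -⟩ := cm_ideal_hypotheses
  have hR0 := EulerEOS.relEnergyThermo_nonneg hG0 hS0 (r := r) hr hΘ hρ hϑ
  refine ⟨hR0, ?_⟩
  have hEe : dens w * (cutEOS σ η₁).e (dens w) (stateTemp (cutEOS σ η₁) (dens w) (ien w)) = ien w := by
    show dens w * (3 / 2 * (2 * ien w / (3 * dens w))) = ien w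
    field_simp
  have hdr : (strongData r W Θ).r = r := rfl
  have hdΘ : (strongData r W Θ).Θ = Θ := rfl
  have hdU : (strongData r W Θ).U = W := rfl
  have hZeq := relEnergyZ_eq (eos := cutEOS σ η₁) (clamp a b) (strongData r W Θ)
    (by rw [hdr]; exact hr.ne') hρ hEe
  have hcut := cm_relEnergyThermo_cut_ge hF hEq hη₁ hη₁₀ hσ (by norm_num : (1 / 2 : ℝ) ≤ 1) hW' hZ1
    hr hΘ hρ hϑ
  rw [hZeq]
  unfold relEnergyFull
  rw [kinetic_eq _ hρ.ne', hdr, hdΘ, hdU, hst]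
  have h1 : 0 ≤ Θ * dens w * ((cutEOS σ η₁).s (dens w) (2 * ien w / (3 * dens w)) -
      clamp a b ((cutEOS σ η₁).s (dens w) (2 * ien w / (3 * dens w)))) :=
    mul_nonneg (mul_nonneg hΘ.le hρ.le) (sub_nonneg.2 (clamp_le_self (b := b) (hst ▸ hsa)))
  linarith

/-! ## The two hot cases: residual and essential coercivity of the ideal gas -/

/-- **Far from the strong state** (`R_ideal ≥ c₀`, BF's growth bounds `ρ ≤ C_d(1 + R)`,
`E_int ≤ C_e(1 + ρ + R)`): `dev ≤ G₀ (2 + 2((1+C_e)(1+C_d) + C_e)(1/c₀ + 1)) ℰ_Z`. -/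
theorem co_case_far {dev G₀ ρ Kin E R c₀ Cd Ce X : ℝ} (hG₀ : 0 ≤ G₀) (hKin : 0 ≤ Kin) (hc₀ : 0 < c₀)
    (hCd : 0 ≤ Cd) (hCe : 0 ≤ Ce) (hR : c₀ ≤ R) (hρC : ρ ≤ Cd * (1 + R)) (hEC : E ≤ Ce * (1 + ρ + R))
    (hX : Kin + R / 2 ≤ X) (hdev : dev ≤ G₀ * (1 + ρ + Kin + E)) :
    dev ≤ G₀ * (2 + 2 * ((1 + Ce) * (1 + Cd) + Ce) * (1 / c₀ + 1)) * X := by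
  have h := cm_arith_far hKin hc₀ hCd hCe hR hρC hEC hX
  have h2 : 1 + ρ + Kin + E ≤ 2 * Kin + ρ + 1 + E := by linarith
  have h3 := mul_le_mul_of_nonneg_left (h2.trans h) hG₀
  linarith [h3]

/-- `|x| ≤ √(2/c₀) √X` from `c₀ x² ≤ R ≤ 2X`. -/
theorem co_abs_le_sqrt {x c₀ R X : ℝ} (hc₀ : 0 < c₀) (hx : c₀ * x ^ 2 ≤ R) (hR : R ≤ 2 * X) :
    |x| ≤ Real.sqrt (2 / c₀) * Real.sqrt X := by
  rw [← Real.sqrt_mul (by positivity)]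
  refine Real.abs_le_sqrt ?_
  rw [div_mul_eq_mul_div, le_div_iff₀ hc₀]
  nlinarith

/-- **Near the strong state** (registered helper sub-goal): from the refined deviation bound, the local
quadratic coercivity `c₀((ρ−r)² + (ϑ−Θ)²) ≤ R ≤ 2(ℰ_Z − Kin)`, `‖m − ρW‖² = 2ρKin` and `ρ ≤ ρM`, the deviation
is `≤ Cₙ (ℰ_Z + √ℰ_Z)` with `Cₙ = (A + 3/2 ρM)√(2/c₀) + B√(2ρM) + 1`. -/
theorem co_case_near {dev A B ny ρ Kin R X c₀ ρM dρ dϑ : ℝ} (hA : 0 ≤ A) (hB : 0 ≤ B) (hny : 0 ≤ ny) (hρ : 0 ≤ ρ) (hρM : ρ ≤ ρM) (hKin : 0 ≤ Kin) (hc₀ : 0 < c₀) (hq : c₀ * (dρ ^ 2 + dϑ ^ 2) ≤ R) (hX : Kin + R / 2 ≤ X) (hy : ny ^ 2 = 2 * ρ * Kin) (hdev : dev ≤ |dρ| * A + ny * B + Kin + 3 / 2 * ρ * |dϑ|) : dev ≤ ((A + 3 / 2 * ρM) * Real.sqrt (2 / c₀) + B * Real.sqrt (2 * ρM) + 1) *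 (X + Real.sqrt X) := by
  have hq0 : 0 ≤ c₀ * (dρ ^ 2 + dϑ ^ 2) := by positivity
  have hR2 : R ≤ 2 * X := by linarith
  have hKX : Kin ≤ X := by linarith
  have hX0 : 0 ≤ X := hKin.trans hKX
  have hsX : 0 ≤ Real.sqrt X := Real.sqrt_nonneg X
  have h1 : |dρ| ≤ Real.sqrt (2 / c₀) * Real.sqrt X :=
    co_abs_le_sqrt hc₀ (by nlinarith [sq_nonneg dϑ]) hR2
  have h2 : |dϑ| ≤ Real.sqrt (2 / c₀) * Real.sqrt X :=
    co_abs_le_sqrt hc₀ (by nlinarith [sq_nonneg dρ]) hR2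
  have hρM0 : 0 ≤ ρM := hρ.trans hρM
  have h3 : ny ≤ Real.sqrt (2 * ρM) * Real.sqrt X := by
    rw [← Real.sqrt_mul (by positivity), show ny = Real.sqrt (ny ^ 2) by rw [Real.sqrt_sq hny]]
    refine Real.sqrt_le_sqrt ?_
    rw [hy]
    calc 2 * ρ * Kin ≤ 2 * ρM * Kin := by nlinarith
      _ ≤ 2 * ρM * X := by nlinarith
  have hs2 : 0 ≤ Real.sqrt (2 / c₀) := Real.sqrt_nonneg _
  have hs3 : 0 ≤ Real.sqrt (2 * ρM) := Real.sqrt_nonneg _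
  have e1 : |dρ| * A ≤ A * Real.sqrt (2 / c₀) * Real.sqrt X := by
    calc |dρ| * A ≤ Real.sqrt (2 / c₀) * Real.sqrt X * A := mul_le_mul_of_nonneg_right h1 hA
      _ = A * Real.sqrt (2 / c₀) * Real.sqrt X := by ring
  have e2 : ny * B ≤ B * Real.sqrt (2 * ρM) * Real.sqrt X := by
    calc ny * B ≤ Real.sqrt (2 * ρM) * Real.sqrt X * B := mul_le_mul_of_nonneg_right h3 hB
      _ = B * Real.sqrt (2 * ρM) * Real.sqrt X := by ring
  have e3 : 3 / 2 * ρ * |dϑ| ≤ 3 / 2 * ρM * Real.sqrt (2 / c₀) * Real.sqrt X := by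
    calc 3 / 2 * ρ * |dϑ| ≤ 3 / 2 * ρM * |dϑ| :=
          mul_le_mul_of_nonneg_right (by linarith) (abs_nonneg dϑ)
      _ ≤ 3 / 2 * ρM * (Real.sqrt (2 / c₀) * Real.sqrt X) :=
          mul_le_mul_of_nonneg_left h2 (by positivity)
      _ = 3 / 2 * ρM * Real.sqrt (2 / c₀) * Real.sqrt X := by ring
  have hC0 : 0 ≤ (A + 3 / 2 * ρM) * Real.sqrt (2 / c₀) + B * Real.sqrt (2 * ρM) := by positivity
  have hexp : ((A + 3 / 2 * ρM) * Real.sqrt (2 / c₀) + B * Real.sqrt (2 * ρM) + 1) * (X + Real.sqrt X) =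
      ((A + 3 / 2 * ρM) * Real.sqrt (2 / c₀) + B * Real.sqrt (2 * ρM)) * X + X +
        (A * Real.sqrt (2 / c₀) * Real.sqrt X + 3 / 2 * ρM * Real.sqrt (2 / c₀) * Real.sqrt X +
          B * Real.sqrt (2 * ρM) * Real.sqrt X) + Real.sqrt X := by ring
  rw [hexp]
  nlinarith [mul_nonneg hC0 hX0]

end Summit.AtomisticToContinuum.HydrodynamicLimit.Theorems.RES

end
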